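import Mathlib.Algebra.Lie.Free
import Mathlib.GroupTheory.FreeGroup.Basic
import Literature.GroupTheory.CombinatorialGroupTheory.MagnusFiltration
import HarnessLib

/-!
# Helper `helper_magnusWittBridge` (the Magnus–Witt bridge for abstract symbol maps) for stub
`stub_layerStepZeroThree` of line `nilpotent-genus-class`, crux `CongruenceShadows.ShadowApproximation`
(item stmt-SmoothPoincare4-14595)

First brick of the certified evaluator needed by the `(0,3)` layer step (design:
`work/stubs/zeroThree/DESIGN.md` of the line folder).  The Magnus–Witt symbols of the free group `F_n` are
available in the tree only ABSTRACTLY (`stub_freeGroupGrLie n`: maps `θₖ : F_n → L(ℤⁿ)` additive on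
`γₖ₊₁ = lcs k`, letters to letters, group commutators to Lie brackets).  To EVALUATE `θₖ w` on an explicit
word one needs a bridge to Magnus' representation.  This file proves it in the generality of the tree's
Magnus formalism (`Literature/GroupTheory/CombinatorialGroupTheory/MagnusFiltration.lean`): for ANY ring `A`
with a descending filtration `E`, ANY unit representation `ρ : F_n →* Aˣ` congruent to `1` modulo `E₁`, and
ANY leading-term data `ld_k : A → 𝔄` into a Lie ring (`IsLeadingTerm`),

  `Λ (θₖ w) = ld_{k+1} (ρ w - 1)` for every `w ∈ γₖ₊₁`,

where `Λ : L(ℤⁿ) → 𝔄` is the Lie morphism sending the letter `i` to `ld₁ (ρ(xᵢ) - 1)`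
(`magnusWitt_bridge`).  With `A` a truncated free associative algebra `ℤ⟨X⟩/(deg > N)`,
`ρ(xᵢ) = 1 + Xᵢ` and `ld_k` = degree-`k` component, `Λ` becomes Witt's embedding `L(ℤⁿ) ↪ ℤ⟨X⟩` and the
bridge reads: `toTensor (θₖ w)` **is the degree-`(k+1)` component of the Magnus expansion of `w`** — which is
computable.  Proof: degree `0` by freeness of `F_n` (both sides are homomorphisms to `(𝔄, +)` agreeing on
letters: additivity of leading terms, `magnus_mul_sub_mem`); degree `k + 1` by induction over the closure
`γₖ₊₂ = ⟨⁅γₖ₊₁, F⁆⟩` (commutators become ring commutators, `magnus_commutator_sub_mem`, and `IsLeadingTerm.lie`).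
No definitions, no notations.
-/

set_option linter.dupNamespace false

noncomputable section

open Literature.GroupTheory.CombinatorialGroupTheory
open scoped commutatorElement

namespace Summit.SmoothPoincare4.SmoothPoincare4.Theorems.ShadowApproximation.NilpotentGenusClass

namespace LayerZeroThree

section Bridge

variable {n : ℕ} (θ : ℕ → FreeGroup (Fin n) → FreeLieAlgebra ℤ (Fin n))
  (hadd : ∀ k, ∀ x ∈ (⊤ : Subgroup (FreeGroup (Fin n))).lowerCentralSeries k,
    ∀ y ∈ (⊤ : Subgroup (FreeGroup (Fin n))).lowerCentralSeries k, θ k (x * y) = θ k x + θ k y)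
  (hof : ∀ i : Fin n, θ 0 (FreeGroup.of i) = FreeLieAlgebra.of ℤ i)
  (hbr : ∀ j k, ∀ x ∈ (⊤ : Subgroup (FreeGroup (Fin n))).lowerCentralSeries j,
    ∀ y ∈ (⊤ : Subgroup (FreeGroup (Fin n))).lowerCentralSeries k, θ (j + k + 1) ⁅x, y⁆ = ⁅θ j x, θ k y⁆)
  {A : Type*} [Ring A] {E : ℕ → AddSubgroup A} (hE : IsDescFiltration E)
  (ρ : FreeGroup (Fin n) →* Aˣ) (hρ : ∀ g, (ρ g : A) - 1 ∈ E 1)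
  {𝔄 : Type*} [LieRing 𝔄] (ld : ℕ → A →+ 𝔄) (hld : IsLeadingTerm E ld)

include hadd in
/-- `θₖ 1 = 0` and `θₖ x⁻¹ = -θₖ x` on `γₖ₊₁` (every rank `n`). [folklore] -/
theorem theta_one_inv (k : ℕ) : θ k 1 = 0 ∧
    ∀ x ∈ (⊤ : Subgroup (FreeGroup (Fin n))).lowerCentralSeries k, θ k x⁻¹ = -θ k x := by
  have h1 : θ k 1 = 0 := by
    have h := hadd k 1 (one_mem _) 1 (one_mem _)
    rw [mul_one] at h
    simpa using h
  refine ⟨h1, fun x hx => ?_⟩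
  have h := hadd k x hx x⁻¹ (inv_mem hx)
  rw [mul_inv_cancel, h1] at h
  exact eq_neg_of_add_eq_zero_right h.symm

include hE hρ hld in
/-- Leading terms are additive along the lower central series: `ld_{k+1}(ρ(xy) - 1) = ld_{k+1}(ρ x - 1) + ld_{k+1}(ρ y - 1)`
for `x, y ∈ γₖ₊₁`. [folklore] -/
theorem ld_mul (k : ℕ) {x y : FreeGroup (Fin n)} (hx : x ∈ (⊤ : Subgroup (FreeGroup (Fin n))).lowerCentralSeries k)
    (hy : y ∈ (⊤ : Subgroup (FreeGroup (Fin n))).lowerCentralSeries k) :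
    ld (k + 1) ((ρ (x * y) : A) - 1) = ld (k + 1) ((ρ x : A) - 1) + ld (k + 1) ((ρ y : A) - 1) := by
  rw [← map_add]
  exact hld.eq_of_sub_mem (magnus_mul_sub_mem hE ρ hρ hx hy)

include hE hρ hld in
/-- Leading terms of inverses: `ld_{k+1}(ρ x⁻¹ - 1) = -ld_{k+1}(ρ x - 1)` for `x ∈ γₖ₊₁`. [folklore] -/
theorem ld_inv (k : ℕ) {x : FreeGroup (Fin n)} (hx : x ∈ (⊤ : Subgroup (FreeGroup (Fin n))).lowerCentralSeries k) :
    ld (k + 1) ((ρ x⁻¹ : A) - 1) = -ld (k + 1) ((ρ x : A) - 1) := by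
  have h := ld_mul hE ρ hρ ld hld k (inv_mem hx) hx
  rw [inv_mul_cancel, map_one, Units.val_one, sub_self, map_zero] at h
  exact eq_neg_of_add_eq_zero_left h.symm

include hadd hof hE hρ hld in
/-- **The bridge in degree one**: `Λ (θ₀ w) = ld₁ (ρ w - 1)` for every `w ∈ F_n` — both sides are homomorphisms
`F_n → (𝔄, +)` agreeing on the letters. [folklore] -/
theorem magnusWitt_bridge_zero (w : FreeGroup (Fin n)) :
    FreeLieAlgebra.lift ℤ (fun i => ld 1 ((ρ (FreeGroup.of i) : A) - 1)) (θ 0 w) = ld 1 ((ρ w : A) - 1) := by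
  set Λ := FreeLieAlgebra.lift ℤ (fun i => ld 1 ((ρ (FreeGroup.of i) : A) - 1)) with hΛ
  set f : FreeGroup (Fin n) →* Multiplicative 𝔄 :=
    { toFun := fun w => Multiplicative.ofAdd (Λ (θ 0 w))
      map_one' := by rw [(theta_one_inv θ hadd 0).1, map_zero]; rfl
      map_mul' := fun x y => by
        rw [hadd 0 x (Subgroup.mem_top x) y (Subgroup.mem_top y), map_add]; rfl } with hf
  set g : FreeGroup (Fin n) →* Multiplicative 𝔄 :=
    { toFun := fun w => Multiplicative.ofAdd (ld 1 ((ρ w : A) - 1))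
      map_one' := by rw [map_one, Units.val_one, sub_self, map_zero]; rfl
      map_mul' := fun x y => by
        rw [ld_mul hE ρ hρ ld hld 0 (Subgroup.mem_top x) (Subgroup.mem_top y)]; rfl } with hg
  have hfg : f = g := FreeGroup.ext_hom f g fun i => by
    simp only [hf, hg, MonoidHom.coe_mk, OneHom.coe_mk, hof, hΛ, FreeLieAlgebra.lift_of_apply]
  have h1 := DFunLike.congr_fun hfg w
  simp only [hf, hg, MonoidHom.coe_mk, OneHom.coe_mk] at h1
  exact Multiplicative.ofAdd.injective h1

include hadd hof hbr hE hρ hld in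
/-- **The Magnus–Witt bridge.** For symbol maps `θ` of `F_n` (additive on `γₖ₊₁`, letters to letters, commutators to
brackets), a unit representation `ρ : F_n →* Aˣ` congruent to `1` modulo a descending filtration `E` of the ring `A`
and leading-term data `ld` into a Lie ring `𝔄`:  `Λ (θₖ w) = ld_{k+1} (ρ w - 1)` for all `w ∈ γₖ₊₁`, where
`Λ : L(ℤⁿ) → 𝔄` is the Lie morphism with `Λ(xᵢ) = ld₁(ρ(xᵢ) - 1)`. [folklore] -/
theorem magnusWitt_bridge (k : ℕ) : ∀ w ∈ (⊤ : Subgroup (FreeGroup (Fin n))).lowerCentralSeries k,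
    FreeLieAlgebra.lift ℤ (fun i => ld 1 ((ρ (FreeGroup.of i) : A) - 1)) (θ k w) = ld (k + 1) ((ρ w : A) - 1) := by
  set Λ := FreeLieAlgebra.lift ℤ (fun i => ld 1 ((ρ (FreeGroup.of i) : A) - 1)) with hΛ
  induction k with
  | zero => exact fun w _ => magnusWitt_bridge_zero θ hadd hof hE ρ hρ ld hld w
  | succ k ih =>
    intro w hw
    have hcl : ∀ x : FreeGroup (Fin n), x ∈ Subgroup.closure {g | ∃ p ∈ (⊤ : Subgroup (FreeGroup (Fin n))).lowerCentralSeries k,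
        ∃ q ∈ (⊤ : Subgroup (FreeGroup (Fin n))), ⁅p, q⁆ = g} →
        x ∈ (⊤ : Subgroup (FreeGroup (Fin n))).lowerCentralSeries (k + 1) := fun x hx => by
      change x ∈ ⁅(⊤ : Subgroup (FreeGroup (Fin n))).lowerCentralSeries k, (⊤ : Subgroup (FreeGroup (Fin n)))⁆
      rw [Subgroup.commutator_def]
      exact hx
    have hw' : w ∈ Subgroup.closure {g | ∃ p ∈ (⊤ : Subgroup (FreeGroup (Fin n))).lowerCentralSeries k,
        ∃ q ∈ (⊤ : Subgroup (FreeGroup (Fin n))), ⁅p, q⁆ = g} := by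
      change w ∈ ⁅(⊤ : Subgroup (FreeGroup (Fin n))).lowerCentralSeries k, (⊤ : Subgroup (FreeGroup (Fin n)))⁆ at hw
      rw [Subgroup.commutator_def] at hw
      exact hw
    refine Subgroup.closure_induction (p := fun x _ => Λ (θ (k + 1) x) = ld (k + 1 + 1) ((ρ x : A) - 1))
      ?_ ?_ ?_ ?_ hw'
    · rintro _ ⟨p, hp, q, -, rfl⟩
      have e1 : θ (k + 1) ⁅p, q⁆ = ⁅θ k p, θ 0 q⁆ := by
        have := hbr k 0 p hp q (Subgroup.mem_top q)
        simpa using this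
      rw [e1, LieHom.map_lie, ih p hp, magnusWitt_bridge_zero θ hadd hof hE ρ hρ ld hld q,
        hld.lie (k + 1) 1 _ _ (magnus_sub_one_mem hE ρ hρ k p hp) (by simpa using hρ q)]
      exact (hld.eq_of_sub_mem (magnus_commutator_sub_mem (n := 0) hE ρ hρ hp (Subgroup.mem_top q))).symm
    · rw [(theta_one_inv θ hadd (k + 1)).1, map_zero, map_one, Units.val_one, sub_self, map_zero]
    · intro x y hx hy ihx ihy
      rw [hadd (k + 1) x (hcl x hx) y (hcl y hy), map_add, ihx, ihy, ld_mul hE ρ hρ ld hld (k + 1) (hcl x hx) (hcl y hy)]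
    · intro x hx ihx
      rw [(theta_one_inv θ hadd (k + 1)).2 x (hcl x hx), map_neg, ihx, ld_inv hE ρ hρ ld hld (k + 1) (hcl x hx)]

end Bridge

end LayerZeroThree

/-- **Registered helper `helper_magnusWittBridge`** (sub-goal of stub `stub_layerStepZeroThree`, item
stmt-SmoothPoincare4-14595): the Magnus–Witt bridge for abstract symbol maps of the free group `F_n`, in closed form —
for `θ` additive on `γₖ₊₁`, letters to letters, commutators to brackets (as delivered by `stub_freeGroupGrLie n`), any
unit representation `ρ : F_n →* Aˣ` congruent to `1` modulo a descending ring filtration `E` and any leading-term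
data `ld` into a Lie ring: `Λ (θₖ w) = ld_{k+1}(ρ w - 1)` on `γₖ₊₁`, `Λ` the Lie morphism with
`Λ(xᵢ) = ld₁(ρ(xᵢ) - 1)`. [folklore] -/
theorem helper_magnusWittBridge : ∀ (n : ℕ) (θ : ℕ → FreeGroup (Fin n) → FreeLieAlgebra ℤ (Fin n)), (∀ k, ∀ x ∈ (⊤ : Subgroup (FreeGroup (Fin n))).lowerCentralSeries k, ∀ y ∈ (⊤ : Subgroup (FreeGroup (Fin n))).lowerCentralSeries k, θ k (x * y) = θ k x + θ k y) → (∀ i : Fin n, θ 0 (FreeGroup.of i) = FreeLieAlgebra.of ℤ i) → (∀ j k, ∀ x ∈ (⊤ : Subgroup (FreeGroup (Fin n))).lowerCentralSeries j, ∀ y ∈ (⊤ : Subgroup (FreeGroup (Fin n))).lowerCentralSeries k, θ (j + k + 1) ⁅x, y⁆ = ⁅θ j x, θ k y⁆) → ∀ {A : Type*} [Ring A] (E : ℕ → AddSubgroup A), Literature.GroupTheory.CombinatorialGroupTheory.IsDescFiltration E → ∀ (ρ : FreeGroup (Fin n) →* Aˣ), (∀ g, (ρ g : A) - 1 ∈ E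 1) → ∀ {𝔄 : Type*} [LieRing 𝔄] (ld : ℕ → A →+ 𝔄), Literature.GroupTheory.CombinatorialGroupTheory.IsLeadingTerm E ld → ∀ (k : ℕ), ∀ w ∈ (⊤ : Subgroup (FreeGroup (Fin n))).lowerCentralSeries k, FreeLieAlgebra.lift ℤ (fun i => ld 1 ((ρ (FreeGroup.of i) : A) - 1)) (θ k w) = ld (k + 1) ((ρ w : A) - 1) :=
  fun _ θ hadd hof hbr _ _ _ hE ρ hρ _ _ ld hld k w hw =>
    LayerZeroThree.magnusWitt_bridge θ hadd hof hbr hE ρ hρ ld hld k w hw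

end Summit.SmoothPoincare4.SmoothPoincare4.Theorems.ShadowApproximation.NilpotentGenusClass

end
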